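import Mathlib
import Literature.Computability.Complexity.RangeAvoidance

/-!
# Prop. A conclusion lemma (pnp-ideate-p3 ROUND-17, rung F-N2 item K0): degree-2 sign-representation certificates

Generic over the locality `k` and over per-output tables: if every output table `P_j` of a `k`-local map is
sign-represented with integer margin `τ` by a degree-≤2 polynomial
`g_j(U) = c₀(j) + Σ_i c₁(j,i)·U_i + Σ_{i,i'} c₂(j,i,i')·U_i U_{i'}` (in `±1` coordinates), then for any
target sign vector `Y ∈ {±1}^m` whose induced BIAS `B = Σ_j Y_j c₀(j)`, STAR LOADS
`D_v = Σ_{(j,i): vars j i = v} Y_j c₁(j,i)` and PAIR FORM `M(X) = Σ_j Y_j Σ_{i,i'} c₂(j,i,i') X_{vars j i} X_{vars j i'}`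
satisfy `B + Σ_v |D_v| + sup_X M(X) < τ·m`, the bit-string `y_j = [Y_j = −1]` is outside the range.
(The sfm-bl engine supplies the bound on `M`; greedy signing the bound on `Σ|D_v|`.)  FRONTIER; nothing
here bears on P vs NP.
-/

namespace Summit.PneNP.PneNP.Theorems.SignRepCertificate

open Literature.Computability.Complexity Finset

variable {k n m : ℕ}

/-- `±1` reading of a bit (`false ↦ 1`, `true ↦ −1`). -/
def pm (b : Bool) : ℤ := if b then -1 else 1

/-- A degree-≤2 integer certificate for the tables of a `k`-local map: coefficients and a margin. -/
structure Cert (I : LocalMap k n m) where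
  /-- constant coefficients -/
  c0 : Fin m → ℤ
  /-- linear coefficients -/
  c1 : Fin m → Fin k → ℤ
  /-- quadratic coefficients (ordered slot pairs; diagonal allowed) -/
  c2 : Fin m → Fin k → Fin k → ℤ
  /-- margin -/
  τ : ℤ
  /-- sign-representation with margin: `pm (P_j u) · g_j(u) ≥ τ` at every point -/
  valid : ∀ (j : Fin m) (u : Fin k → Bool),
    τ ≤ pm (I.table j u) *
      (c0 j + ∑ i : Fin k, c1 j i * pm (u i) + ∑ i : Fin k, ∑ i' : Fin k, c2 j i i' * pm (u i) * pm (u i'))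

/-- The polynomial `g_j` evaluated at the local view of a global `±1` assignment `X`. -/
def gEval (I : LocalMap k n m) (c : Cert I) (X : Fin n → ℤ) (j : Fin m) : ℤ :=
  c.c0 j + ∑ i : Fin k, c.c1 j i * X (I.vars j i) + ∑ i : Fin k, ∑ i' : Fin k, c.c2 j i i' * X (I.vars j i) * X (I.vars j i')

/-- Bias of a sign vector against the certificate. -/
def bias (I : LocalMap k n m) (c : Cert I) (Y : Fin m → ℤ) : ℤ := ∑ j : Fin m, Y j * c.c0 j

/-- Weighted star load of position `v`. -/
def load (I : LocalMap k n m) (c : Cert I) (Y : Fin m → ℤ) (v : Fin n) : ℤ :=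
  ∑ j : Fin m, ∑ i : Fin k, if I.vars j i = v then Y j * c.c1 j i else 0

/-- The signed pair form evaluated at a global `±1` assignment. -/
def pairForm (I : LocalMap k n m) (c : Cert I) (Y : Fin m → ℤ) (X : Fin n → ℤ) : ℤ :=
  ∑ j : Fin m, Y j * ∑ i : Fin k, ∑ i' : Fin k, c.c2 j i i' * X (I.vars j i) * X (I.vars j i')

/-- Decomposition of the signed certificate sum into bias + star part + pair part. -/
lemma sum_gEval_eq (I : LocalMap k n m) (c : Cert I) (Y : Fin m → ℤ) (X : Fin n → ℤ) :
    ∑ j : Fin m, Y j * gEval I c X j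
      = bias I c Y + ∑ v : Fin n, X v * load I c Y v + pairForm I c Y X := by
  have star : ∑ j : Fin m, Y j * ∑ i : Fin k, c.c1 j i * X (I.vars j i) = ∑ v : Fin n, X v * load I c Y v := by
    have key : ∀ j i, Y j * (c.c1 j i * X (I.vars j i))
        = ∑ v : Fin n, X v * (if I.vars j i = v then Y j * c.c1 j i else 0) := by
      intro j i
      simp_rw [mul_ite, mul_zero]
      rw [Finset.sum_ite_eq]
      simp; ring
    calc ∑ j : Fin m, Y j * ∑ i : Fin k, c.c1 j i * X (I.vars j i)
        = ∑ j : Fin m, ∑ i : Fin k, Y j * (c.c1 j i * X (I.vars j i)) := by simp_rw [Finset.mul_sum]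
      _ = ∑ j : Fin m, ∑ i : Fin k, ∑ v : Fin n, X v * (if I.vars j i = v then Y j * c.c1 j i else 0) := by
          simp_rw [key]
      _ = ∑ j : Fin m, ∑ v : Fin n, ∑ i : Fin k, X v * (if I.vars j i = v then Y j * c.c1 j i else 0) :=
          Finset.sum_congr rfl fun j _ => Finset.sum_comm
      _ = ∑ v : Fin n, ∑ j : Fin m, ∑ i : Fin k, X v * (if I.vars j i = v then Y j * c.c1 j i else 0) :=
          Finset.sum_comm
      _ = ∑ v : Fin n, X v * load I c Y v := by simp_rw [load, Finset.mul_sum]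
  unfold gEval bias pairForm
  simp_rw [mul_add, Finset.sum_add_distrib]
  rw [star]

/-- A preimage of the bit-string `y_j = [Y_j = −1]` makes every output sign equal to `Y_j`. -/
lemma pm_table_eq (I : LocalMap k n m) (Y : Fin m → ℤ) (hY : ∀ j, Y j = 1 ∨ Y j = -1)
    (x : Fin n → Bool) (hx : I.eval x = fun j => decide (Y j = -1)) (j : Fin m) :
    pm (I.table j (fun i => x (I.vars j i))) = Y j := by
  have h := congrFun hx j
  simp only [LocalMap.eval] at h
  rcases hY j with hj | hj
  · rw [hj] at h ⊢; simp at h; simp [pm, h]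
  · rw [hj] at h ⊢; simp at h; simp [pm, h]

/-- **Prop. A conclusion lemma.** Bias + total star load + a uniform bound on the pair form below `τ·m`
certify that `y` is outside the range. -/
theorem not_mem_range_of_certificate (I : LocalMap k n m) (c : Cert I) (Y : Fin m → ℤ)
    (hY : ∀ j, Y j = 1 ∨ Y j = -1) (e : ℤ)
    (hpair : ∀ X : Fin n → ℤ, (∀ v, X v = 1 ∨ X v = -1) → pairForm I c Y X ≤ e)
    (hsum : bias I c Y + ∑ v : Fin n, |load I c Y v| + e < c.τ * m) :
    (fun j => decide (Y j = -1)) ∉ I.range := by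
  rintro ⟨x, hx⟩
  set X : Fin n → ℤ := fun v => pm (x v) with hX
  have hXpm : ∀ v, X v = 1 ∨ X v = -1 := fun v => by simp only [hX, pm]; cases x v <;> simp
  -- per output: τ ≤ Y j * g_j(X)
  have hout : ∀ j, c.τ ≤ Y j * gEval I c X j := by
    intro j
    have hv := c.valid j (fun i => x (I.vars j i))
    rw [pm_table_eq I Y hY x hx j] at hv
    simpa [gEval, hX] using hv
  have hm : c.τ * m ≤ ∑ j : Fin m, Y j * gEval I c X j := by
    calc c.τ * m = ∑ _j : Fin m, c.τ := by simp [mul_comm]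
      _ ≤ _ := Finset.sum_le_sum fun j _ => hout j
  rw [sum_gEval_eq] at hm
  have hstar : ∑ v : Fin n, X v * load I c Y v ≤ ∑ v : Fin n, |load I c Y v| :=
    Finset.sum_le_sum fun v _ => by
      have h1 : |X v| = 1 := by rcases hXpm v with h | h <;> simp [h]
      calc X v * load I c Y v ≤ |X v * load I c Y v| := le_abs_self _
        _ = |load I c Y v| := by rw [abs_mul, h1, one_mul]
  have hp := hpair X hXpm
  omega

end Summit.PneNP.PneNP.Theorems.SignRepCertificate
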